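import Literature.Analysis.FluidPDE.Seregin2020ScaledEnergyBounds
import Literature.Analysis.FluidPDE.CKNInterpolationEstimate
import HarnessLib

/-!
# Seregin 2020, the step "`g(z₀) < ∞ ⇒ G(z₀) < ∞`" of the proof of Theorem 2.1: the case of a
# bounded energy quantity `A`

Analysis/FluidPDE proof file (everything proved; no definitions, no named facts), continuing
`Seregin2020ScaledEnergyBounds.lean` on the way to the discharge of the named fact
`Literature.Analysis.FluidPDE.Seregin2020_axisymmetricSingularPoint_typeII`
(G. Seregin, Anal. Math. Phys. 10 (2020), Paper 46 = arXiv:2006.04140, Thm. 2.1). That file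
treats the case `limsup C < ∞` of the remark following Def. 1.7 ("if `g(z₀) < ∞`, see
[Seregin2006], then `G(z₀) < ∞`"); this one treats the case **`limsup_{r→0} A(z₀, r) < ∞`**,
by reduction to the case `C`.

## The argument (Seregin 2006; Seregin 2014, §6.1, in the plain quantities `A, E, C, D`)

With `A(r) ≤ M` on `]0, r₀]` and `Q_{r₀}(z) ⊆ Q` (the cylinders may touch the top of `Q`):

* the multiplicative inequality in the finer form `C(R) ≤ C₀ A(R)^{3/4} (A(R) + E(R))^{3/4}`
  (`exists_cknC_le_finer`, the form reached inside the tree's proof of Robinson–Rodrigo–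
  Sadowski's Lemma 15.10, `exists_cknC_one_le`; Seregin 2014, proof of Lemma 6.2) makes `C(R)`
  a SUBLINEAR function of `E(R)`: `C(R) ≤ C₀ M^{3/4} (M + E(R))^{3/4}`;
* the local energy bound at the top (`localEnergyBound_top`) and the monotonicity
  `E(θR) ≤ (2θ)⁻¹ E(R/2)` give
  `E(θR) ≤ (2θ)⁻¹ [c₁ C(R)^{2/3} + c₂ C(R) + c₃ D(R)^{2/3} C(R)^{1/3}]`;
* the pressure decay estimate gives `D(θR) ≤ c (θ D(R) + θ⁻² C(R))`
  (`seregin_sverak_pressure_decay_holds`).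

Choosing `θ` with `cθ ≤ 1/4`, splitting `D^{2/3}C^{1/3} ≤ (2/3) s D + (1/3) s⁻² C` (Young) with
`s` small, and absorbing the sublinear powers of `M + E(R)` (`rpow_le_mul_add`), the functional
`Ψ(r) = E(r) + D(r)` satisfies `Ψ(θR) ≤ Ψ(R)/2 + b` for `0 < R ≤ r₀`; the geometric iteration
(`iterate_half_le`) bounds `Ψ(θᵏ r₀)`, monotonicity fills the intermediate radii, so `E` and hence
`C` are bounded on `]0, r₀]`, and `scaledEnergies_bounded_of_cknC_le` concludes.

## Contents (namespace `Literature.Analysis.FluidPDE.Seregin2020`)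

* `exists_cknC_one_le_finer`, `exists_cknC_le_finer` — the multiplicative inequality, finer form;
* `rpow_le_mul_add` — absorption `k x^p ≤ ε x + (k ε^{-p})^{1/(1-p)}` in `ℝ≥0∞` (`0 < p < 1`);
* `rpow_two_thirds_mul_rpow_one_third_le` — Young `D^{2/3} C^{1/3} ≤ s D + s⁻² C`;
* `scaledEnergies_bounded_of_cknAEss_le` — **the case `A`**: `A ≤ M` on `]0, r₀]`,
  `E(r₀), D(r₀) < ∞` give `A + E + C + D ≤ K` on `]0, r₀/2]`;
* `scaledEnergies_bounded_of_limsup_cknAEss_lt_top`, `…_of_limsup_cknA_lt_top` — from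
  `limsup A < ∞` (essential supremum, resp. the genuine supremum `cknA ≥ cknAEss` of
  `Seregin2020.blowupIndex`).

## References

* G. Seregin, Anal. Math. Phys. 10 (2020), Paper 46 = arXiv:2006.04140: remark after Def. 1.7,
  (2.7). [`Seregin2020`]
* G. Seregin, *Lecture Notes on Regularity Theory for the Navier–Stokes Equations* (2014), §6.1,
  Lemmas 6.2–6.4 and the proof of Thm. 1.4. [`Seregin2014`]
* J. C. Robinson, J. L. Rodrigo, W. Sadowski, *The three-dimensional Navier–Stokes equations*
  (2016), Lemma 15.10. [`RobinsonRodrigoSadowski2016`]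
-/

noncomputable section

open MeasureTheory Set Function Filter Topology TopologicalSpace Metric
open scoped NNReal ENNReal

namespace Literature.Analysis.FluidPDE

namespace Seregin2020

/-! ### The multiplicative inequality in the finer form `C ≤ C₀ A^{3/4} (A + E)^{3/4}` -/

/-- **The multiplicative inequality at unit scale, finer form**: there is an absolute `C₀` such
that for every `u` with weak spatial gradient `G` on `Q₁(0)` and `A(1), E(1) < ∞`,
`C(1) ≤ C₀ A(1)^{3/4} (A(1) + E(1))^{3/4}` — the form reached inside the proof of
`exists_cknC_one_le` (Robinson–Rodrigo–Sadowski 2016, Lemma 15.10) before the last weakening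
`A^{3/4} ≤ (A + E)^{3/4}`; it is the "known multiplicative inequality"
`∫_{B} |v|³ ≤ c[(∫|∇v|²)^{3/4}(∫|v|²)^{3/4} + r^{-3/2}(∫|v|²)^{3/2}]` of Seregin 2014, proof of
Lemma 6.2, integrated in time. [cite: Seregin2014, proof of Lemma 6.2 (multiplicative inequality)] -/
theorem exists_cknC_one_le_finer :
    ∃ C₀ : ℝ≥0, ∀ (u : ℝ → EuclideanSpace ℝ (Fin 3) → EuclideanSpace ℝ (Fin 3))
      (G : ℝ → EuclideanSpace ℝ (Fin 3) → EuclideanSpace ℝ (Fin 3) →L[ℝ] EuclideanSpace ℝ (Fin 3)),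
      HasWeakSpatialGradientOn (parabolicCylinderOpens 1 0) u G →
      cknAEss 1 0 u ≠ ∞ → cknE 1 0 G ≠ ∞ →
      cknC 1 0 u ≤ C₀ * cknAEss 1 0 u ^ (3 / 4 : ℝ) * (cknAEss 1 0 u + cknE 1 0 G) ^ (3 / 4 : ℝ) := by
  obtain ⟨CS, hCS⟩ := exists_eLpNorm_six_le_unitBall
  refine ⟨(2 * CS) ^ (3 / 2 : ℝ), fun u G h hA hE => ?_⟩
  -- notation
  set B : Set (EuclideanSpace ℝ (Fin 3)) := ball 0 1 with hB
  set I : Set ℝ := Ioo (-1) 0 with hI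
  set a : ℝ → ℝ≥0∞ := fun t => ∫⁻ x in B, ‖u t x‖ₑ ^ 2 with ha
  set e : ℝ → ℝ≥0∞ := fun t => ∫⁻ x in B, ENNReal.ofReal (frobeniusNormSq (G t x)) with he
  set c : ℝ → ℝ≥0∞ := fun t => ∫⁻ x in B, ‖u t x‖ₑ ^ (3 : ℕ) with hc
  have hQ : parabolicCylinder 1 (0 : ℝ × EuclideanSpace ℝ (Fin 3)) = I ×ˢ B := by
    simp [parabolicCylinder, hI, hB]
  have hQI : Ioo ((0 : ℝ × EuclideanSpace ℝ (Fin 3)).1 - 1 ^ 2) (0 : ℝ × EuclideanSpace ℝ (Fin 3)).1 = I := by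
    simp [hI]
  -- the quantities at unit scale
  have hAeq : cknAEss 1 0 u = essSup a (volume.restrict I) := by
    simp only [cknAEss, ENNReal.ofReal_one, inv_one, one_mul, hQI]
    rfl
  have hEeq : cknE 1 0 G = ∫⁻ q in I ×ˢ B, ENNReal.ofReal (frobeniusNormSq (G q.1 q.2)) := by
    simp only [cknE, ENNReal.ofReal_one, inv_one, one_mul, hQ]
  have hCeq : cknC 1 0 u = ∫⁻ q in I ×ˢ B, ‖u q.1 q.2‖ₑ ^ (3 : ℕ) := by
    simp only [cknC, ENNReal.ofReal_one, one_pow, inv_one, one_mul, hQ]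
  -- measurability on the cylinder
  have hQsub : I ×ˢ B ⊆ ((parabolicCylinderOpens 1 (0 : ℝ × EuclideanSpace ℝ (Fin 3)) :
      Opens (ℝ × EuclideanSpace ℝ (Fin 3))) : Set (ℝ × EuclideanSpace ℝ (Fin 3))) := by
    rw [coe_parabolicCylinderOpens, hQ]
  have hum : AEStronglyMeasurable (uncurry u) (volume.restrict (I ×ˢ B)) :=
    (h.locallyIntegrableOn.mono_set hQsub).aestronglyMeasurable
  have hGm : AEStronglyMeasurable (uncurry G) (volume.restrict (I ×ˢ B)) :=
    (h.locallyIntegrableOn_grad.mono_set hQsub).aestronglyMeasurable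
  have hprod : (volume.restrict (I ×ˢ B) : Measure (ℝ × EuclideanSpace ℝ (Fin 3))) =
      (volume.restrict I).prod (volume.restrict B) := by
    rw [Measure.volume_eq_prod, Measure.prod_restrict]
  have hum3 : AEMeasurable (fun q : ℝ × EuclideanSpace ℝ (Fin 3) => ‖u q.1 q.2‖ₑ ^ (3 : ℕ))
      ((volume.restrict I).prod (volume.restrict B)) := by
    rw [← hprod]; exact (hum.enorm.pow_const 3)
  have hum2 : AEMeasurable (fun q : ℝ × EuclideanSpace ℝ (Fin 3) => ‖u q.1 q.2‖ₑ ^ (2 : ℕ))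
      ((volume.restrict I).prod (volume.restrict B)) := by
    rw [← hprod]; exact (hum.enorm.pow_const 2)
  have hGm2 : AEMeasurable (fun q : ℝ × EuclideanSpace ℝ (Fin 3) =>
      ENNReal.ofReal (frobeniusNormSq (G q.1 q.2))) ((volume.restrict I).prod (volume.restrict B)) := by
    rw [← hprod]
    exact (continuous_frobeniusNormSq'.comp_aestronglyMeasurable hGm).aemeasurable.ennreal_ofReal
  -- Tonelli
  have hEeq' : cknE 1 0 G = ∫⁻ t in I, e t := by
    rw [hEeq, Measure.volume_eq_prod, setLIntegral_prod _ (by rwa [← Measure.prod_restrict])]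
  have hCeq' : cknC 1 0 u = ∫⁻ t in I, c t := by
    rw [hCeq, Measure.volume_eq_prod, setLIntegral_prod _ (by rwa [← Measure.prod_restrict])]
  have ham : AEMeasurable a (volume.restrict I) := hum2.lintegral_prod_right'
  have hem : AEMeasurable e (volume.restrict I) := hGm2.lintegral_prod_right'
  -- a.e. in time: energy bound, finite dissipation, weak derivative of the slice
  set A := cknAEss 1 0 u with hAdef
  set EE := cknE 1 0 G with hEdef
  have h1 : ∀ᵐ t ∂(volume.restrict I), a t ≤ A := by
    rw [hAeq]; exact ENNReal.ae_le_essSup a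
  have h2 : ∀ᵐ t ∂(volume.restrict I), e t < ∞ := by
    refine ae_lt_top' hem ?_
    rw [← hEeq']; exact hE
  have h3 : ∀ᵐ t ∂(volume.restrict I), FunctionSpaces.HasWeakFDerivOn
      (⟨B, isOpen_ball⟩ : Opens (EuclideanSpace ℝ (Fin 3))) volume (u t) (G t) := by
    have := h.ae_hasWeakFDerivOn_ball
    rwa [hQI] at this
  -- the pointwise-in-time estimate
  have hAtop : A ≠ ∞ := hA
  have hpt : ∀ᵐ t ∂(volume.restrict I),
      c t ≤ A ^ (3 / 4 : ℝ) * (((2 * CS : ℝ≥0) : ℝ≥0∞) ^ (3 / 2 : ℝ) * (a t + e t) ^ (3 / 4 : ℝ)) := by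
    filter_upwards [h1, h2, h3] with t hat het hwt
    have hat' : a t ≠ ∞ := ne_top_of_le_ne_top hAtop hat
    -- measurability of the slice
    have hutm : AEStronglyMeasurable (u t) (volume.restrict B) :=
      hwt.locallyIntegrableOn.aestronglyMeasurable
    -- `‖u t‖_{L²(B)} = a(t)^{1/2}`
    have hL2 : eLpNorm (u t) 2 (volume.restrict B) = a t ^ (1 / 2 : ℝ) := by
      rw [eLpNorm_eq_lintegral_rpow_enorm_toReal two_ne_zero ENNReal.ofNat_ne_top,
        ENNReal.toReal_ofNat, ha]
      simp only [one_div]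
      congr 1
      refine lintegral_congr fun x => ?_
      rw [show (2 : ℝ) = ((2 : ℕ) : ℝ) by norm_num, ENNReal.rpow_natCast]
    have hL2' : eLpNorm (u t) 2 (volume.restrict B) ≠ ∞ := by
      rw [hL2]; exact ENNReal.rpow_ne_top_of_nonneg (by norm_num) hat'
    -- Sobolev on the slice
    have hS : eLpNorm (u t) 6 (volume.restrict B) ≤
        CS * (a t ^ (1 / 2 : ℝ) + e t ^ (1 / 2 : ℝ)) := by
      have := hCS (u t) (G t) hwt hL2'
      rwa [hL2] at this
    have hS2 : eLpNorm (u t) 6 (volume.restrict B) ≤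
        ((2 * CS : ℝ≥0) : ℝ≥0∞) * (a t + e t) ^ (1 / 2 : ℝ) := by
      refine hS.trans ?_
      have h1' : a t ^ (1 / 2 : ℝ) ≤ (a t + e t) ^ (1 / 2 : ℝ) :=
        ENNReal.rpow_le_rpow le_self_add (by norm_num)
      have h2' : e t ^ (1 / 2 : ℝ) ≤ (a t + e t) ^ (1 / 2 : ℝ) :=
        ENNReal.rpow_le_rpow le_add_self (by norm_num)
      calc (CS : ℝ≥0∞) * (a t ^ (1 / 2 : ℝ) + e t ^ (1 / 2 : ℝ))
          ≤ CS * ((a t + e t) ^ (1 / 2 : ℝ) + (a t + e t) ^ (1 / 2 : ℝ)) := by gcongr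
        _ = ((2 * CS : ℝ≥0) : ℝ≥0∞) * (a t + e t) ^ (1 / 2 : ℝ) := by push_cast; ring
    -- `(∫ |u t|⁶)^{1/4} = ‖u t‖_{L⁶}^{3/2}`
    have hL6 : (∫⁻ x in B, ‖u t x‖ₑ ^ (6 : ℝ)) ^ (1 / 4 : ℝ) =
        eLpNorm (u t) 6 (volume.restrict B) ^ (3 / 2 : ℝ) := by
      rw [eLpNorm_eq_lintegral_rpow_enorm_toReal (by norm_num) ENNReal.ofNat_ne_top,
        ENNReal.toReal_ofNat, ← ENNReal.rpow_mul]
      norm_num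
    -- Hölder in space
    have hH := lintegral_pow_three_le_Lp_interpolation (volume.restrict B) hutm.enorm
    calc c t ≤ a t ^ (3 / 4 : ℝ) * (∫⁻ x in B, ‖u t x‖ₑ ^ (6 : ℝ)) ^ (1 / 4 : ℝ) := hH
      _ = a t ^ (3 / 4 : ℝ) * eLpNorm (u t) 6 (volume.restrict B) ^ (3 / 2 : ℝ) := by rw [hL6]
      _ ≤ A ^ (3 / 4 : ℝ) * (((2 * CS : ℝ≥0) : ℝ≥0∞) * (a t + e t) ^ (1 / 2 : ℝ)) ^ (3 / 2 : ℝ) := by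
          gcongr
      _ = A ^ (3 / 4 : ℝ) * (((2 * CS : ℝ≥0) : ℝ≥0∞) ^ (3 / 2 : ℝ) * (a t + e t) ^ (3 / 4 : ℝ)) := by
          rw [ENNReal.mul_rpow_of_nonneg _ _ (by norm_num), ← ENNReal.rpow_mul]
          norm_num
  -- integrate in time
  have hK : A ^ (3 / 4 : ℝ) * ((2 * CS : ℝ≥0) : ℝ≥0∞) ^ (3 / 2 : ℝ) ≠ ∞ :=
    ENNReal.mul_ne_top (ENNReal.rpow_ne_top_of_nonneg (by norm_num) hAtop)
      (ENNReal.rpow_ne_top_of_nonneg (by norm_num) ENNReal.coe_ne_top)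
  have hvolI : (volume.restrict I : Measure ℝ) univ ≤ 1 := by
    rw [Measure.restrict_apply_univ, hI, Real.volume_Ioo]; norm_num
  have hint_a : ∫⁻ t in I, a t ≤ A := by
    calc ∫⁻ t in I, a t ≤ ∫⁻ _ in I, A := lintegral_mono_ae h1
      _ = A * (volume.restrict I) univ := lintegral_const A
      _ ≤ A * 1 := by gcongr
      _ = A := mul_one A
  calc cknC 1 0 u = ∫⁻ t in I, c t := hCeq'
    _ ≤ ∫⁻ t in I, A ^ (3 / 4 : ℝ) * (((2 * CS : ℝ≥0) : ℝ≥0∞) ^ (3 / 2 : ℝ) *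
          (a t + e t) ^ (3 / 4 : ℝ)) := lintegral_mono_ae hpt
    _ = A ^ (3 / 4 : ℝ) * ((2 * CS : ℝ≥0) : ℝ≥0∞) ^ (3 / 2 : ℝ) *
          ∫⁻ t in I, (a t + e t) ^ (3 / 4 : ℝ) := by
        rw [← lintegral_const_mul' _ _ hK]
        refine lintegral_congr fun t => ?_
        ring
    _ ≤ A ^ (3 / 4 : ℝ) * ((2 * CS : ℝ≥0) : ℝ≥0∞) ^ (3 / 2 : ℝ) *
          (∫⁻ t in I, (a t + e t)) ^ (3 / 4 : ℝ) := by
        gcongr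
        exact lintegral_rpow_three_quarters_le _ hvolI (ham.add hem)
    _ ≤ A ^ (3 / 4 : ℝ) * ((2 * CS : ℝ≥0) : ℝ≥0∞) ^ (3 / 2 : ℝ) * (A + EE) ^ (3 / 4 : ℝ) := by
        gcongr
        rw [lintegral_add_left' ham, ← hEeq']
        gcongr
    _ = (((2 * CS) ^ (3 / 2 : ℝ) : ℝ≥0) : ℝ≥0∞) * A ^ (3 / 4 : ℝ) * (A + EE) ^ (3 / 4 : ℝ) := by
        rw [ENNReal.coe_rpow_of_nonneg _ (by norm_num)]
        push_cast
        ring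

/-- **The multiplicative inequality, finer form** `C(r) ≤ C₀ A(r)^{3/4} (A(r) + E(r))^{3/4}` for
every backward cylinder `Q_r(z)` on which `u` has the weak spatial gradient `G` and
`A(r), E(r)` are finite (`A = cknAEss`, `E = cknE`, `C = cknC`); from the unit-scale case by the
Navier–Stokes scaling. Equivalent (up to constants) to Seregin's
`C(r) ≤ c[A^{3/4}(r)E^{3/4}(r) + A^{3/2}(r)]` (Seregin 2014, proof of Lemma 6.2 with `ϱ = r`).
[cite: Seregin2014, proof of Lemma 6.2 (multiplicative inequality)] -/
theorem exists_cknC_le_finer :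
    ∃ C₀ : ℝ≥0, ∀ (u : ℝ → EuclideanSpace ℝ (Fin 3) → EuclideanSpace ℝ (Fin 3))
      (G : ℝ → EuclideanSpace ℝ (Fin 3) → EuclideanSpace ℝ (Fin 3) →L[ℝ] EuclideanSpace ℝ (Fin 3))
      (z : ℝ × EuclideanSpace ℝ (Fin 3)) (r : ℝ), 0 < r →
      HasWeakSpatialGradientOn (parabolicCylinderOpens r z) u G →
      cknAEss r z u ≠ ∞ → cknE r z G ≠ ∞ →
      cknC r z u ≤ C₀ * cknAEss r z u ^ (3 / 4 : ℝ) * (cknAEss r z u + cknE r z G) ^ (3 / 4 : ℝ) := by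
  obtain ⟨C₀, hC₀⟩ := exists_cknC_one_le_finer
  refine ⟨C₀, fun u G z r hr h hA hE => ?_⟩
  have hr2 : 0 < r ^ 2 := by positivity
  have hz : stAffine (r ^ 2) r z.1 z.2 (0 : ℝ × EuclideanSpace ℝ (Fin 3)) = z :=
    Prod.ext (by simp [stAffine]) (by simp [stAffine])
  have hC : cknC 1 0 (r • stPull (r ^ 2) r z.1 z.2 u) = cknC r z u := by
    simpa [hz] using cknC_nsZoom hr one_pos z.1 z.2 0 u
  have hAe : cknAEss 1 0 (r • stPull (r ^ 2) r z.1 z.2 u) = cknAEss r z u := by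
    simpa [hz] using cknAEss_nsZoom hr one_pos z.1 z.2 0 u
  have hEe : cknE 1 0 (r ^ 2 • stPull (r ^ 2) r z.1 z.2 G) = cknE r z G := by
    simpa [hz] using cknE_nsZoom hr one_pos z.1 z.2 0 G
  have hw : HasWeakSpatialGradientOn (parabolicCylinderOpens 1 0) (r • stPull (r ^ 2) r z.1 z.2 u)
      (r ^ 2 • stPull (r ^ 2) r z.1 z.2 G) := by
    have := h.stRescale r hr2 hr z.1 z.2
    rwa [stPreimage_parabolicCylinderOpens_self hr, ← sq] at this
  have := hC₀ _ _ hw (by rwa [hAe]) (by rwa [hEe])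
  rwa [hC, hAe, hEe] at this


/-! ### Two elementary absorption inequalities in `ℝ≥0∞` -/

/-- **Absorption of a sublinear power**: for `0 < p < 1`, `0 < ε < ∞` and any `k`,
`k x^p ≤ ε x + (k ε^{-p})^{1/(1-p)}` (Young's inequality with exponents `1/p`, `1/(1-p)` applied
to `(εx)^p · kε^{-p}`). [folklore] -/
theorem rpow_le_mul_add {p : ℝ} (hp0 : 0 < p) (hp1 : p < 1) (k x : ℝ≥0∞) {ε : ℝ≥0∞}
    (hε : ε ≠ 0) (hε' : ε ≠ ∞) :
    k * x ^ p ≤ ε * x + (k * ε⁻¹ ^ p) ^ (1 / (1 - p)) := by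
  have hpq : (1 / p).HolderConjugate (1 / (1 - p)) := by
    rw [Real.holderConjugate_iff]
    refine ⟨by rw [lt_div_iff₀ hp0]; linarith, ?_⟩
    rw [one_div, one_div, inv_inv, inv_inv]; ring
  have key := ENNReal.young_inequality ((ε * x) ^ p) (k * ε⁻¹ ^ p) hpq
  have hab : (ε * x) ^ p * (k * ε⁻¹ ^ p) = k * x ^ p := by
    rw [ENNReal.mul_rpow_of_nonneg _ _ hp0.le]
    calc ε ^ p * x ^ p * (k * ε⁻¹ ^ p) = (ε ^ p * ε⁻¹ ^ p) * (k * x ^ p) := by ring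
      _ = k * x ^ p := by
          rw [← ENNReal.mul_rpow_of_nonneg _ _ hp0.le, ENNReal.mul_inv_cancel hε hε',
            ENNReal.one_rpow, one_mul]
  have ha : ((ε * x) ^ p) ^ (1 / p) = ε * x := by
    rw [← ENNReal.rpow_mul, one_div, mul_inv_cancel₀ hp0.ne', ENNReal.rpow_one]
  rw [hab, ha] at key
  refine key.trans (add_le_add ?_ ?_)
  · rw [div_eq_mul_inv]
    refine mul_le_of_le_one_right zero_le (ENNReal.inv_le_one.2 ?_)
    rw [← ENNReal.ofReal_one]
    exact ENNReal.ofReal_le_ofReal (by rw [le_div_iff₀ hp0]; linarith)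
  · rw [div_eq_mul_inv]
    refine mul_le_of_le_one_right zero_le (ENNReal.inv_le_one.2 ?_)
    rw [← ENNReal.ofReal_one]
    exact ENNReal.ofReal_le_ofReal (by rw [le_div_iff₀ (by linarith)]; linarith)

/-- **Young's inequality for the pressure–velocity term**: for `0 < s < ∞`,
`D^{2/3} C^{1/3} ≤ s D + s⁻² C` in `ℝ≥0∞` (exponents `3/2` and `3` applied to
`(sD)^{2/3} (s⁻²C)^{1/3}`). [folklore] -/
theorem rpow_two_thirds_mul_rpow_one_third_le (D C : ℝ≥0∞) {s : ℝ≥0∞} (hs : s ≠ 0)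
    (hs' : s ≠ ∞) :
    D ^ (2 / 3 : ℝ) * C ^ (1 / 3 : ℝ) ≤ s * D + s⁻¹ ^ 2 * C := by
  have hpq : (3 / 2 : ℝ).HolderConjugate 3 := Real.holderConjugate_iff.2 ⟨by norm_num, by norm_num⟩
  have key := ENNReal.young_inequality ((s * D) ^ (2 / 3 : ℝ)) ((s⁻¹ ^ 2 * C) ^ (1 / 3 : ℝ)) hpq
  have hab : (s * D) ^ (2 / 3 : ℝ) * (s⁻¹ ^ 2 * C) ^ (1 / 3 : ℝ) =
      D ^ (2 / 3 : ℝ) * C ^ (1 / 3 : ℝ) := by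
    rw [ENNReal.mul_rpow_of_nonneg _ _ (by norm_num : (0 : ℝ) ≤ 2 / 3),
      ENNReal.mul_rpow_of_nonneg _ _ (by norm_num : (0 : ℝ) ≤ 1 / 3)]
    have h1 : s ^ (2 / 3 : ℝ) * (s⁻¹ ^ 2) ^ (1 / 3 : ℝ) = 1 := by
      rw [show (s⁻¹ ^ 2 : ℝ≥0∞) = s⁻¹ ^ (2 : ℝ) by rw [← ENNReal.rpow_natCast]; norm_num,
        ← ENNReal.rpow_mul, ENNReal.inv_rpow, ← ENNReal.rpow_neg, ← ENNReal.rpow_add _ _ hs hs']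
      norm_num
    calc s ^ (2 / 3 : ℝ) * D ^ (2 / 3 : ℝ) * ((s⁻¹ ^ 2) ^ (1 / 3 : ℝ) * C ^ (1 / 3 : ℝ))
        = (s ^ (2 / 3 : ℝ) * (s⁻¹ ^ 2) ^ (1 / 3 : ℝ)) * (D ^ (2 / 3 : ℝ) * C ^ (1 / 3 : ℝ)) := by
          ring
      _ = D ^ (2 / 3 : ℝ) * C ^ (1 / 3 : ℝ) := by rw [h1, one_mul]
  have ha : ((s * D) ^ (2 / 3 : ℝ)) ^ (3 / 2 : ℝ) = s * D := by
    rw [← ENNReal.rpow_mul]; norm_num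
  have hb : ((s⁻¹ ^ 2 * C) ^ (1 / 3 : ℝ)) ^ (3 : ℝ) = s⁻¹ ^ 2 * C := by
    rw [← ENNReal.rpow_mul]; norm_num
  rw [hab, ha, hb] at key
  refine key.trans (add_le_add ?_ ?_)
  · rw [div_eq_mul_inv]
    refine mul_le_of_le_one_right zero_le (ENNReal.inv_le_one.2 ?_)
    rw [← ENNReal.ofReal_one]
    exact ENNReal.ofReal_le_ofReal (by norm_num)
  · rw [div_eq_mul_inv]
    refine mul_le_of_le_one_right zero_le (ENNReal.inv_le_one.2 ?_)
    rw [← ENNReal.ofReal_one]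
    exact ENNReal.ofReal_le_ofReal (by norm_num)

/-- `2⁻¹·2⁻¹·x + 2⁻¹·2⁻¹·x = 2⁻¹·x` in `ℝ≥0∞`. [folklore] -/
theorem quarter_add_quarter (x : ℝ≥0∞) :
    2⁻¹ * 2⁻¹ * x + 2⁻¹ * 2⁻¹ * x = 2⁻¹ * x := by
  calc 2⁻¹ * 2⁻¹ * x + 2⁻¹ * 2⁻¹ * x = 2⁻¹ * ((2⁻¹ + 2⁻¹) * x) := by ring
    _ = 2⁻¹ * x := by rw [ENNReal.inv_two_add_inv_two, one_mul]

/-! ### Bounded `A` forces bounded `E`, `C`, `D` (Seregin 2020, remark after Def. 1.7, case `A`) -/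

/-- **Seregin 2020, remark after Def. 1.7 (after Seregin 2006), the case of a bounded energy
quantity.** Let `(u, p)` be a suitable weak solution of the unforced Navier–Stokes equations
(`ν = 1`) on an open `Q ⊆ ℝ × ℝ³`, `G` a weak spatial gradient of `u` on `Q`, and
`Q_{r₀}(z) ⊆ Q` a backward cylinder (possibly touching the top of `Q`) with `E(r₀; z) < ∞`,
`D(r₀; z) < ∞`. If `A(r; z) ≤ M` for all `0 < r ≤ r₀` (`A = cknAEss`), then
`A + E + C + D ≤ K` on `]0, r₀/2]` for some `K < ∞`. Proof: the iteration described in the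
module docstring bounds `E` (hence `C`, by the multiplicative inequality) on `]0, r₀]`, and
`scaledEnergies_bounded_of_cknC_le` applies. [cite: Seregin2020, remark after Def. 1.7 and (2.7)] -/
theorem scaledEnergies_bounded_of_cknAEss_le {Q : Opens (ℝ × EuclideanSpace ℝ (Fin 3))}
    {u : ℝ → EuclideanSpace ℝ (Fin 3) → EuclideanSpace ℝ (Fin 3)}
    {p : ℝ → EuclideanSpace ℝ (Fin 3) → ℝ}
    {G : ℝ → EuclideanSpace ℝ (Fin 3) → EuclideanSpace ℝ (Fin 3) →L[ℝ] EuclideanSpace ℝ (Fin 3)}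
    (hsw : IsSuitableWeakSolutionOn Q 1 0 u p) (hG : HasWeakSpatialGradientOn Q u G)
    {z : ℝ × EuclideanSpace ℝ (Fin 3)} {r₀ : ℝ} (hr₀ : 0 < r₀)
    (hQ : parabolicCylinder r₀ z ⊆ (Q : Set (ℝ × EuclideanSpace ℝ (Fin 3))))
    (hE₀ : cknE r₀ z G ≠ ∞) (hD₀ : cknD r₀ z p ≠ ∞) {M : ℝ≥0}
    (hM : ∀ r ∈ Ioc (0 : ℝ) r₀, cknAEss r z u ≤ M) :
    ∃ K : ℝ≥0, ∀ r ∈ Ioc (0 : ℝ) (r₀ / 2),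
      cknAEss r z u + cknE r z G + cknC r z u + cknD r z p ≤ K := by
  -- ### the constants of the three estimates
  obtain ⟨c, hc⟩ := seregin_sverak_pressure_decay_holds.ratio
  obtain ⟨c₁, c₂, c₃, HT⟩ := localEnergyBound_top
  obtain ⟨C₀, hC₀⟩ := exists_cknC_le_finer
  -- `θ` with `c θ ≤ 1/4`
  obtain ⟨θ, hθ, hθhalf, hcθ2⟩ := exists_ratio_mul_le_half (2 * c)
  have hθ1 : θ ≤ 1 := hθhalf.trans (by norm_num)
  have hcθ : (c : ℝ≥0∞) * ENNReal.ofReal θ ≤ 2⁻¹ * 2⁻¹ := by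
    calc (c : ℝ≥0∞) * ENNReal.ofReal θ = 2⁻¹ * (((2 * c : ℝ≥0) : ℝ≥0∞) * ENNReal.ofReal θ) := by
          push_cast
          rw [← mul_assoc, ← mul_assoc, ENNReal.inv_mul_cancel two_ne_zero ENNReal.ofNat_ne_top,
            one_mul]
      _ ≤ 2⁻¹ * 2⁻¹ := by gcongr
  -- the Young parameter `s` with `(2θ)⁻¹ c₃ s ≤ 1/4`
  set L : ℝ≥0∞ := ENNReal.ofReal ((2 * θ)⁻¹) * c₃ with hL
  have hLtop : L ≠ ∞ := ENNReal.mul_ne_top ENNReal.ofReal_ne_top ENNReal.coe_ne_top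
  set s : ℝ≥0∞ := 2⁻¹ * 2⁻¹ * (L + 1)⁻¹ with hs
  have h2i0 : (2⁻¹ : ℝ≥0∞) ≠ 0 := ENNReal.inv_ne_zero.2 ENNReal.ofNat_ne_top
  have h2it : (2⁻¹ : ℝ≥0∞) ≠ ∞ := ENNReal.inv_ne_top.2 two_ne_zero
  have hs0 : s ≠ 0 := mul_ne_zero (mul_ne_zero h2i0 h2i0)
    (ENNReal.inv_ne_zero.2 (ENNReal.add_ne_top.2 ⟨hLtop, ENNReal.one_ne_top⟩))
  have hstop : s ≠ ∞ := ENNReal.mul_ne_top (ENNReal.mul_ne_top h2it h2it)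
    (ENNReal.inv_ne_top.2 (by simp))
  have hLs : L * s ≤ 2⁻¹ * 2⁻¹ := by
    have h1 : L * (L + 1)⁻¹ ≤ 1 := by
      rw [← div_eq_mul_inv]
      exact ENNReal.div_le_of_le_mul (by rw [one_mul]; exact le_self_add)
    calc L * s = 2⁻¹ * 2⁻¹ * (L * (L + 1)⁻¹) := by rw [hs]; ring
      _ ≤ 2⁻¹ * 2⁻¹ * 1 := by gcongr
      _ = 2⁻¹ * 2⁻¹ := mul_one _
  -- the sublinear majorant of `C`: `C(R) ≤ γ (M + E(R))^{3/4}`, `γ = C₀ M^{3/4}`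
  set γ : ℝ≥0∞ := (C₀ : ℝ≥0∞) * (M : ℝ≥0∞) ^ (3 / 4 : ℝ) with hγ
  have hγtop : γ ≠ ∞ := ENNReal.mul_ne_top ENNReal.coe_ne_top
    (ENNReal.rpow_ne_top_of_nonneg (by norm_num) ENNReal.coe_ne_top)
  -- coefficients of `(M+E)^{1/2}` and `(M+E)^{3/4}`, and the absorption constants
  set α₁ : ℝ≥0∞ := ENNReal.ofReal ((2 * θ)⁻¹) * c₁ * γ ^ (2 / 3 : ℝ) with hα₁
  set α₂ : ℝ≥0∞ := (ENNReal.ofReal ((2 * θ)⁻¹) * (c₂ + c₃ * s⁻¹ ^ 2) +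
    c * ENNReal.ofReal (θ⁻¹ ^ 2)) * γ with hα₂
  have hsi : s⁻¹ ≠ ∞ := ENNReal.inv_ne_top.2 hs0
  have hα₁top : α₁ ≠ ∞ := ENNReal.mul_ne_top
    (ENNReal.mul_ne_top ENNReal.ofReal_ne_top ENNReal.coe_ne_top)
    (ENNReal.rpow_ne_top_of_nonneg (by norm_num) hγtop)
  have hα₂top : α₂ ≠ ∞ := by
    refine ENNReal.mul_ne_top (ENNReal.add_ne_top.2 ⟨?_, ?_⟩) hγtop
    · exact ENNReal.mul_ne_top ENNReal.ofReal_ne_top (ENNReal.add_ne_top.2 ⟨ENNReal.coe_ne_top,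
        ENNReal.mul_ne_top ENNReal.coe_ne_top (ENNReal.pow_ne_top hsi)⟩)
    · exact ENNReal.mul_ne_top ENNReal.coe_ne_top ENNReal.ofReal_ne_top
  set ε : ℝ≥0∞ := 2⁻¹ * 2⁻¹ with hε
  have hε0 : ε ≠ 0 := mul_ne_zero h2i0 h2i0
  have hεtop : ε ≠ ∞ := ENNReal.mul_ne_top h2it h2it
  have hεi : ε⁻¹ ≠ ∞ := ENNReal.inv_ne_top.2 hε0
  set K₁ : ℝ≥0∞ := (α₁ * ε⁻¹ ^ (1 / 2 : ℝ)) ^ (1 / (1 - 1 / 2 : ℝ)) with hK₁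
  set K₂ : ℝ≥0∞ := (α₂ * ε⁻¹ ^ (3 / 4 : ℝ)) ^ (1 / (1 - 3 / 4 : ℝ)) with hK₂
  have hK₁top : K₁ ≠ ∞ := ENNReal.rpow_ne_top_of_nonneg (by norm_num)
    (ENNReal.mul_ne_top hα₁top (ENNReal.rpow_ne_top_of_nonneg (by norm_num) hεi))
  have hK₂top : K₂ ≠ ∞ := ENNReal.rpow_ne_top_of_nonneg (by norm_num)
    (ENNReal.mul_ne_top hα₂top (ENNReal.rpow_ne_top_of_nonneg (by norm_num) hεi))
  set b : ℝ≥0∞ := 2⁻¹ * M + K₁ + K₂ with hb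
  have hbtop : b ≠ ∞ := ENNReal.add_ne_top.2 ⟨ENNReal.add_ne_top.2
    ⟨ENNReal.mul_ne_top h2it ENNReal.coe_ne_top, hK₁top⟩, hK₂top⟩
  -- ### finiteness of `E` below `r₀`
  have hEfin : ∀ R ∈ Ioc (0 : ℝ) r₀, cknE R z G ≠ ∞ := fun R hR =>
    ne_top_of_le_ne_top (ENNReal.mul_ne_top ENNReal.ofReal_ne_top hE₀)
      (cknE_le_mul_of_subset hr₀ hR.1 (parabolicCylinder_mono hR.1.le hR.2 z) G)
  -- ### the majorant of `C`
  have hCR : ∀ R ∈ Ioc (0 : ℝ) r₀, cknC R z u ≤ γ * (M + cknE R z G) ^ (3 / 4 : ℝ) := by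
    intro R hR
    have hQR : parabolicCylinder R z ⊆ (Q : Set (ℝ × EuclideanSpace ℝ (Fin 3))) :=
      (parabolicCylinder_mono hR.1.le hR.2 z).trans hQ
    have hGR : HasWeakSpatialGradientOn (parabolicCylinderOpens R z) u G :=
      hG.mono (fun w hw => hQR hw)
    have hAR : cknAEss R z u ≤ M := hM R hR
    have key := hC₀ u G z R hR.1 hGR (ne_top_of_le_ne_top ENNReal.coe_ne_top hAR) (hEfin R hR)
    calc cknC R z u ≤ C₀ * cknAEss R z u ^ (3 / 4 : ℝ) * (cknAEss R z u + cknE R z G) ^ (3 / 4 : ℝ) :=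
          key
      _ ≤ C₀ * (M : ℝ≥0∞) ^ (3 / 4 : ℝ) * (M + cknE R z G) ^ (3 / 4 : ℝ) := by gcongr
      _ = γ * (M + cknE R z G) ^ (3 / 4 : ℝ) := by rw [hγ]
  have hCR23 : ∀ R ∈ Ioc (0 : ℝ) r₀,
      cknC R z u ^ (2 / 3 : ℝ) ≤ γ ^ (2 / 3 : ℝ) * (M + cknE R z G) ^ (1 / 2 : ℝ) := by
    intro R hR
    calc cknC R z u ^ (2 / 3 : ℝ) ≤ (γ * (M + cknE R z G) ^ (3 / 4 : ℝ)) ^ (2 / 3 : ℝ) :=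
          ENNReal.rpow_le_rpow (hCR R hR) (by norm_num)
      _ = γ ^ (2 / 3 : ℝ) * (M + cknE R z G) ^ (1 / 2 : ℝ) := by
          rw [ENNReal.mul_rpow_of_nonneg _ _ (by norm_num), ← ENNReal.rpow_mul]
          norm_num
  -- ### the one-step inequality for `Ψ = E + D`
  have step : ∀ R, 0 < R → R ≤ r₀ →
      cknE (θ * R) z G + cknD (θ * R) z p ≤ (cknE R z G + cknD R z p) / 2 + b := by
    intro R hR0 hRr
    have hR : R ∈ Ioc (0 : ℝ) r₀ := ⟨hR0, hRr⟩
    have hQR : parabolicCylinder R z ⊆ (Q : Set (ℝ × EuclideanSpace ℝ (Fin 3))) :=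
      (parabolicCylinder_mono hR0.le hRr z).trans hQ
    set EE := cknE R z G with hEE
    set D := cknD R z p with hDdef
    set C := cknC R z u with hCdef
    set X := (M : ℝ≥0∞) + EE with hX
    -- the dissipation at `θR` through `R/2`
    have hE1 : cknE (θ * R) z G ≤ ENNReal.ofReal ((2 * θ)⁻¹) *
        (c₁ * C ^ (2 / 3 : ℝ) + c₂ * C + c₃ * (D ^ (2 / 3 : ℝ) * C ^ (1 / 3 : ℝ))) := by
      have hsub : parabolicCylinder (θ * R) z ⊆ parabolicCylinder (R / 2) z :=
        parabolicCylinder_mono (by positivity) (by nlinarith) z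
      have hmono := cknE_le_mul_of_subset (half_pos hR0) (mul_pos hθ hR0) hsub G
      have e1 : R / 2 / (θ * R) = (2 * θ)⁻¹ := by field_simp
      rw [e1] at hmono
      have hT := HT Q u p G hsw hG z R hR0 hQR
      calc cknE (θ * R) z G ≤ ENNReal.ofReal ((2 * θ)⁻¹) * cknE (R / 2) z G := hmono
        _ ≤ ENNReal.ofReal ((2 * θ)⁻¹) * (cknAEss (R / 2) z u + cknE (R / 2) z G) := by
            gcongr; exact le_add_self
        _ ≤ _ := by gcongr
    -- the pressure at `θR`
    have hD1 : cknD (θ * R) z p ≤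
        c * (ENNReal.ofReal θ * D + ENNReal.ofReal ((θ⁻¹) ^ 2) * C) :=
      hc Q u p hsw.distributional z R θ hR0 hθ hθ1 hQR
    -- Young for the mixed term
    have hY : D ^ (2 / 3 : ℝ) * C ^ (1 / 3 : ℝ) ≤ s * D + s⁻¹ ^ 2 * C :=
      rpow_two_thirds_mul_rpow_one_third_le D C hs0 hstop
    -- absorption of the sublinear powers of `X = M + E`
    have hab1 : α₁ * X ^ (1 / 2 : ℝ) ≤ ε * X + K₁ :=
      rpow_le_mul_add (by norm_num) (by norm_num) α₁ X hε0 hεtop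
    have hab2 : α₂ * X ^ (3 / 4 : ℝ) ≤ ε * X + K₂ :=
      rpow_le_mul_add (by norm_num) (by norm_num) α₂ X hε0 hεtop
    -- combine
    calc cknE (θ * R) z G + cknD (θ * R) z p
        ≤ ENNReal.ofReal ((2 * θ)⁻¹) *
            (c₁ * C ^ (2 / 3 : ℝ) + c₂ * C + c₃ * (s * D + s⁻¹ ^ 2 * C)) +
          c * (ENNReal.ofReal θ * D + ENNReal.ofReal ((θ⁻¹) ^ 2) * C) := by
          gcongr
          exact hE1.trans (by gcongr)
      _ = (L * s) * D + (c * ENNReal.ofReal θ) * D +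
          ENNReal.ofReal ((2 * θ)⁻¹) * c₁ * C ^ (2 / 3 : ℝ) +
          (ENNReal.ofReal ((2 * θ)⁻¹) * (c₂ + c₃ * s⁻¹ ^ 2) + c * ENNReal.ofReal (θ⁻¹ ^ 2)) * C := by
          rw [hL]; ring
      _ ≤ (2⁻¹ * 2⁻¹) * D + (2⁻¹ * 2⁻¹) * D +
          ENNReal.ofReal ((2 * θ)⁻¹) * c₁ * (γ ^ (2 / 3 : ℝ) * X ^ (1 / 2 : ℝ)) +
          (ENNReal.ofReal ((2 * θ)⁻¹) * (c₂ + c₃ * s⁻¹ ^ 2) + c * ENNReal.ofReal (θ⁻¹ ^ 2)) *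
            (γ * X ^ (3 / 4 : ℝ)) := by
          gcongr
          · exact hCR23 R hR
          · exact hCR R hR
      _ = 2⁻¹ * D + α₁ * X ^ (1 / 2 : ℝ) + α₂ * X ^ (3 / 4 : ℝ) := by
          rw [quarter_add_quarter, hα₁, hα₂]; ring
      _ ≤ 2⁻¹ * D + (ε * X + K₁) + (ε * X + K₂) := by gcongr
      _ = 2⁻¹ * D + 2⁻¹ * X + K₁ + K₂ := by
          rw [hε, ← quarter_add_quarter X]; ring
      _ = (EE + D) / 2 + b := by
          rw [hX, hb, div_eq_mul_inv]; ring
  -- ### the iteration and the bound on `E` along `θᵏ r₀`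
  set Ψ₀ : ℝ≥0∞ := 2 * b + (cknE r₀ z G + cknD r₀ z p) with hΨ₀
  have hΨ₀top : Ψ₀ ≠ ∞ := ENNReal.add_ne_top.2
    ⟨ENNReal.mul_ne_top ENNReal.ofNat_ne_top hbtop, ENNReal.add_ne_top.2 ⟨hE₀, hD₀⟩⟩
  have hiter : ∀ k : ℕ, cknE (θ ^ k * r₀) z G + cknD (θ ^ k * r₀) z p ≤ Ψ₀ := by
    intro k
    have := iterate_half_le (φ := fun ρ => cknE ρ z G + cknD ρ z p) hθ hθ1 hr₀ step k
    refine this.trans ?_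
    rw [hΨ₀]
    gcongr
    calc (2⁻¹ : ℝ≥0∞) ^ k * (cknE r₀ z G + cknD r₀ z p) ≤ 1 * (cknE r₀ z G + cknD r₀ z p) := by
          gcongr
          exact pow_le_one₀ zero_le (ENNReal.inv_le_one.2 one_le_two)
      _ = _ := one_mul _
  -- ### `E` at every radius `0 < r ≤ r₀`
  have hEr : ∀ r ∈ Ioc (0 : ℝ) r₀, cknE r z G ≤ ENNReal.ofReal (θ⁻¹) * Ψ₀ := by
    intro r hr
    obtain ⟨J, hJ1, hJ2⟩ := exists_nat_pow_near_of_lt_one (div_pos hr.1 hr₀)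
      ((div_le_one hr₀).2 hr.2) hθ (by linarith)
    have hle : r ≤ θ ^ J * r₀ := by rwa [div_le_iff₀ hr₀] at hJ2
    have hlt : θ ^ J * r₀ < θ⁻¹ * r := by
      rw [lt_div_iff₀ hr₀] at hJ1
      have : θ ^ J * r₀ = θ⁻¹ * (θ ^ (J + 1) * r₀) := by
        rw [pow_succ]; field_simp
      rw [this]
      exact mul_lt_mul_of_pos_left hJ1 (inv_pos.2 hθ)
    have hsub : parabolicCylinder r z ⊆ parabolicCylinder (θ ^ J * r₀) z :=
      parabolicCylinder_mono hr.1.le hle z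
    calc cknE r z G ≤ ENNReal.ofReal (θ ^ J * r₀ / r) * cknE (θ ^ J * r₀) z G :=
          cknE_le_mul_of_subset (by positivity) hr.1 hsub G
      _ ≤ ENNReal.ofReal (θ⁻¹) * Ψ₀ := by
          gcongr
          · exact (div_le_iff₀ hr.1).2 hlt.le
          · exact le_self_add.trans (hiter J)
  -- ### `C` bounded on `]0, r₀]`, and the case `C`
  set Cbar : ℝ≥0∞ := γ * (M + ENNReal.ofReal (θ⁻¹) * Ψ₀) ^ (3 / 4 : ℝ) with hCbar
  have hCbartop : Cbar ≠ ∞ := ENNReal.mul_ne_top hγtop (ENNReal.rpow_ne_top_of_nonneg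
    (by norm_num) (ENNReal.add_ne_top.2 ⟨ENNReal.coe_ne_top,
      ENNReal.mul_ne_top ENNReal.ofReal_ne_top hΨ₀top⟩))
  have hCb : ∀ r ∈ Ioc (0 : ℝ) r₀, cknC r z u ≤ (Cbar.toNNReal : ℝ≥0∞) := by
    intro r hr
    rw [ENNReal.coe_toNNReal hCbartop, hCbar]
    refine (hCR r hr).trans ?_
    gcongr
    exact hEr r hr
  exact scaledEnergies_bounded_of_cknC_le hsw hG hr₀ hQ hD₀ hCb

/-- **The case `limsup_{r→0} A(z, r) < ∞` of "`g < ∞ ⇒ G < ∞`"** (Seregin 2020, remark after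
Def. 1.7, after Seregin 2006), with `A = cknAEss` (essential supremum in time): for a suitable
weak solution on `Q ⊇ Q_{r₀}(z)` with `E(r₀; z), D(r₀; z) < ∞`, a finite upper limit of the energy
quantity at `z` bounds `A, E, C, D` at `z` on some `]0, r₁]`. [cite: Seregin2020, remark after Def. 1.7 and (2.7)] -/
theorem scaledEnergies_bounded_of_limsup_cknAEss_lt_top {Q : Opens (ℝ × EuclideanSpace ℝ (Fin 3))}
    {u : ℝ → EuclideanSpace ℝ (Fin 3) → EuclideanSpace ℝ (Fin 3)}
    {p : ℝ → EuclideanSpace ℝ (Fin 3) → ℝ}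
    {G : ℝ → EuclideanSpace ℝ (Fin 3) → EuclideanSpace ℝ (Fin 3) →L[ℝ] EuclideanSpace ℝ (Fin 3)}
    (hsw : IsSuitableWeakSolutionOn Q 1 0 u p) (hG : HasWeakSpatialGradientOn Q u G)
    {z : ℝ × EuclideanSpace ℝ (Fin 3)} {r₀ : ℝ} (hr₀ : 0 < r₀)
    (hQ : parabolicCylinder r₀ z ⊆ (Q : Set (ℝ × EuclideanSpace ℝ (Fin 3))))
    (hE₀ : cknE r₀ z G ≠ ∞) (hD₀ : cknD r₀ z p ≠ ∞)
    (hA : limsup (fun r => cknAEss r z u) (𝓝[>] 0) < ∞) :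
    ∃ K : ℝ≥0, ∃ r₁ : ℝ, 0 < r₁ ∧ ∀ r ∈ Ioc (0 : ℝ) r₁,
      cknAEss r z u + cknE r z G + cknC r z u + cknD r z p ≤ K := by
  obtain ⟨M, ρ, hρ, hM⟩ := exists_bound_of_limsup_lt_top hA
  set r₂ := min ρ r₀ with hr₂
  have hr₂0 : 0 < r₂ := lt_min hρ hr₀
  have hr₂ρ : r₂ ≤ ρ := min_le_left _ _
  have hr₂r₀ : r₂ ≤ r₀ := min_le_right _ _
  have hsub : parabolicCylinder r₂ z ⊆ parabolicCylinder r₀ z := parabolicCylinder_mono hr₂0.le hr₂r₀ z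
  have hQ₂ : parabolicCylinder r₂ z ⊆ (Q : Set (ℝ × EuclideanSpace ℝ (Fin 3))) := hsub.trans hQ
  have hD₂ : cknD r₂ z p ≠ ∞ :=
    ne_top_of_le_ne_top (ENNReal.mul_ne_top (ENNReal.pow_ne_top ENNReal.ofReal_ne_top) hD₀)
      (cknD_le_mul_of_subset hr₀ hr₂0 hsub p)
  have hE₂ : cknE r₂ z G ≠ ∞ :=
    ne_top_of_le_ne_top (ENNReal.mul_ne_top ENNReal.ofReal_ne_top hE₀)
      (cknE_le_mul_of_subset hr₀ hr₂0 hsub G)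
  have hM₂ : ∀ r ∈ Ioc (0 : ℝ) r₂, cknAEss r z u ≤ M := fun r hr => hM r ⟨hr.1, hr.2.trans hr₂ρ⟩
  obtain ⟨K, hK⟩ := scaledEnergies_bounded_of_cknAEss_le hsw hG hr₂0 hQ₂ hE₂ hD₂ hM₂
  exact ⟨K, r₂ / 2, half_pos hr₂0, hK⟩

/-- The same from a finite upper limit of the **genuine supremum** `cknA ≥ cknAEss` (the
quantity entering `Seregin2020.blowupIndex`). [cite: Seregin2020, remark after Def. 1.7 and (2.7)] -/
theorem scaledEnergies_bounded_of_limsup_cknA_lt_top {Q : Opens (ℝ × EuclideanSpace ℝ (Fin 3))}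
    {u : ℝ → EuclideanSpace ℝ (Fin 3) → EuclideanSpace ℝ (Fin 3)}
    {p : ℝ → EuclideanSpace ℝ (Fin 3) → ℝ}
    {G : ℝ → EuclideanSpace ℝ (Fin 3) → EuclideanSpace ℝ (Fin 3) →L[ℝ] EuclideanSpace ℝ (Fin 3)}
    (hsw : IsSuitableWeakSolutionOn Q 1 0 u p) (hG : HasWeakSpatialGradientOn Q u G)
    {z : ℝ × EuclideanSpace ℝ (Fin 3)} {r₀ : ℝ} (hr₀ : 0 < r₀)
    (hQ : parabolicCylinder r₀ z ⊆ (Q : Set (ℝ × EuclideanSpace ℝ (Fin 3))))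
    (hE₀ : cknE r₀ z G ≠ ∞) (hD₀ : cknD r₀ z p ≠ ∞)
    (hA : limsup (fun r => cknA r z u) (𝓝[>] 0) < ∞) :
    ∃ K : ℝ≥0, ∃ r₁ : ℝ, 0 < r₁ ∧ ∀ r ∈ Ioc (0 : ℝ) r₁,
      cknAEss r z u + cknE r z G + cknC r z u + cknD r z p ≤ K := by
  refine scaledEnergies_bounded_of_limsup_cknAEss_lt_top hsw hG hr₀ hQ hE₀ hD₀ (lt_of_le_of_lt ?_ hA)
  exact limsup_le_limsup (Eventually.of_forall fun r => cknAEss_le_cknA)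

end Seregin2020

end Literature.Analysis.FluidPDE
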